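import Literature.RepresentationTheory.HeisenbergGroup.SchrodingerL2Unitary
import Literature.RepresentationTheory.HeisenbergGroup.StoneVonNeumann
import HarnessLib

/-!
# The unitary Schrödinger representation on `L²(Fⁿ)` is IRREDUCIBLE (Stone–von Neumann, irreducibility half)

Topic `RepresentationTheory/HeisenbergGroup`; namespace `Literature.RepresentationTheory.HeisenbergGroup`.  KERNEL ONLY:
theorems; no definition, no named fact, no record, no `sorry`.

For a non-archimedean normed field `F` with compact closed balls, an invertible matrix `T ∈ GL_n(F)` (pairing
`β_T(u, y) = u · T y` on `Fⁿ × Fⁿ`), a non-trivial continuous character `ψ : F → S¹` and a Haar measure `ν` on `Fⁿ`, the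
unitary Schrödinger representation `schrodingerL2 β_T ψ ν` of `H(Fⁿ ⊕ Fⁿ)` on `L²(Fⁿ, ν)` (`SchrodingerL2Unitary.lean`):

* §1 its operators at `((x, 0), 0)` and `((0, y), 0)` ARE the translation `τ_x` and the modulation by the Heisenberg
  character `u ↦ ψ(∑ (T y)ᵢ uᵢ)` of the `L²` Schrödinger system (`SchrodingerSystem.lean`):
  `schrodingerL2_inl_apply`, `schrodingerL2_inr_apply`;
* §2 **`hasScalarCommutant_schrodingerL2`** — every bounded operator of `L²(Fⁿ, ν)` commuting with all `ρ_ψ(h)` is a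
  scalar (the tree's Stone–von Neumann file `StoneVonNeumann.lean`, `hasScalarCommutant_schrodingerSystem_pi`, applied
  to the system generated by §1; `T` invertible so that every Heisenberg character occurs);
* §3 **`schrodingerL2_irreducible`** — TOPOLOGICAL IRREDUCIBILITY in the form printed in [GelbartRogawski1991, §3.1
  p. 454 L19–21] ("an irreducible unitary representation of `H(W)` with central character `ψ`"): a CLOSED subspace of
  `L²(Fⁿ, ν)` invariant under all `ρ_ψ(h)` is `⊥` or `⊤` (the orthogonal projection onto it commutes with the `ρ_ψ(h)` —
  unitarity — hence is a scalar by §2).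

With `schrodingerL2_ofCenter` / `norm_schrodingerL2_apply` (`SchrodingerL2Unitary.lean`) this makes `(L²(Fⁿ, ν), ρ_ψ)` an
irreducible unitary representation of the Heisenberg group with central character `ψ` in the kernel; the UNIQUENESS half
of the Stone–von Neumann theorem (any other such representation is unitarily equivalent) is not addressed.  Nothing of the
cited sources is asserted.

## References
* [MoeglinVignerasWaldspurger1987] C. Mœglin, M.-F. Vignéras, J.-L. Waldspurger, LNM 1291 (1987), Chap. 2 I.2–I.4
  ("Théorème (Stone, Von Neumann)"; irreducibility of the models `S_A`).
* [Weil1964] A. Weil, Acta Math. 111 (1964) 143–211, Chap. I n° 11–12.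
* [GelbartRogawski1991] S. Gelbart, J. Rogawski, Invent. Math. 105 (1991), §3.1 p. 454 L17–21.
-/

set_option autoImplicit false

noncomputable section

open _root_.MeasureTheory Set _root_.Filter
open Literature.NumberTheory.Automorphic
open scoped ENNReal NNReal Topology InnerProductSpace

namespace Literature.RepresentationTheory.HeisenbergGroup

open SchrodingerLevi SchrodingerIrreducible

variable {F : Type*} [NormedField F] {n : ℕ} (T : Matrix (Fin n) (Fin n) F) (ψ : AddChar F Circle)
  (hψl : IsLocallyConstant (⇑ψ : F → Circle))

/-- `β_T(·, y) = (u ↦ u · T y)` is continuous. [folklore] -/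
private theorem continuous_matrixPairing_left (y : Fin n → F) :
    Continuous fun u : Fin n → F => Matrix.toLinearMap₂' F T u y := by
  simp only [Matrix.toLinearMap₂'_apply', dotProduct]
  exact continuous_finsetSum _ fun i _ => (continuous_apply i).mul continuous_const

variable [MeasurableSpace (Fin n → F)] [BorelSpace (Fin n → F)] (ν : Measure (Fin n → F)) [ν.IsAddHaarMeasure]
  (hd : DenseRange (SchwartzBruhat.toLp ν : SchwartzBruhat (Fin n → F) → Lp ℂ 2 ν))

/-! ## §1 The Schrödinger operators at `(x, 0)` and `(0, y)` are the translation and the character modulation -/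

/-- **`ρ_ψ((x, 0), 0) = τ_x`** on `L²(Fⁿ, ν)`: the unitary extension of `Φ ↦ Φ(· + x)` is the translation operator of
the `L²` Schrödinger system. [cite: MoeglinVignerasWaldspurger1987, Chap. 2 I.4 Exemple (1)] -/
theorem schrodingerL2_inl_apply (x : Fin n → F) (f : Lp ℂ 2 ν) :
    schrodingerL2 (Matrix.toLinearMap₂' F T) ψ hψl (continuous_matrixPairing_left T) ν hd ⟨(x, 0), 0⟩ f =
      translate ν x f := by
  refine congrFun (hd.equalizer (continuous_schrodingerL2 _ _ _ _ _ hd _) (translate ν x).continuous ?_) f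
  funext Φ
  simp only [Function.comp_apply, schrodingerL2_apply_toLp]
  refine Lp.ext (((SchwartzBruhat.coeFn_toLp ν _).trans ?_).trans
    ((coeFn_translate ν x _).trans ((measurePreserving_add_right ν x).quasiMeasurePreserving.ae_eq_comp
      (SchwartzBruhat.coeFn_toLp ν Φ))).symm)
  refine Eventually.of_forall fun u => ?_
  show ((ψ (0 + Matrix.toLinearMap₂' F T u 0) : Circle) : ℂ) * (Φ : (Fin n → F) → ℂ) (u + x) =
    (Φ : (Fin n → F) → ℂ) (u + x)
  rw [map_zero, add_zero, AddChar.map_zero_eq_one, Circle.coe_one, one_mul]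

/-- **`ρ_ψ((0, y), 0) = M_{χ_{T y}}`**, the modulation by the Heisenberg character `u ↦ ψ(∑ (T y)ᵢ uᵢ) = ψ(u · T y)`.
[cite: MoeglinVignerasWaldspurger1987, Chap. 2 I.3, I.4 Exemple (1)] -/
theorem schrodingerL2_inr_apply [IsUltrametricDist F] (hψc : Continuous ψ) (y : Fin n → F) (f : Lp ℂ 2 ν) :
    schrodingerL2 (Matrix.toLinearMap₂' F T) ψ hψl (continuous_matrixPairing_left T) ν hd ⟨(0, y), 0⟩ f =
      modulate ν (heisChar ψ hψc (T.mulVec y)) f := by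
  refine congrFun (hd.equalizer (continuous_schrodingerL2 _ _ _ _ _ hd _) (modulate ν _).continuous ?_) f
  funext Φ
  simp only [Function.comp_apply, schrodingerL2_apply_toLp]
  refine Lp.ext (((SchwartzBruhat.coeFn_toLp ν _).trans ?_).trans
    ((coeFn_modulate ν _ _).trans
      ((EventuallyEq.refl _ fun u => ((heisChar ψ hψc (T.mulVec y) u : Circle) : ℂ)).mul
        (SchwartzBruhat.coeFn_toLp ν Φ))).symm)
  refine Eventually.of_forall fun u => ?_
  show ((ψ (0 + Matrix.toLinearMap₂' F T u y) : Circle) : ℂ) * (Φ : (Fin n → F) → ℂ) (u + 0) =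
    ((heisChar ψ hψc (T.mulVec y) u : Circle) : ℂ) * (Φ : (Fin n → F) → ℂ) u
  rw [zero_add, add_zero, heisChar_apply, Matrix.toLinearMap₂'_apply', dotProduct_comm]
  rfl

/-! ## §2 Scalar commutant -/

/-- **every bounded operator on `L²(Fⁿ, ν)` commuting with all Schrödinger operators `ρ_ψ(h)` is a scalar** (`T`
invertible, `ψ` non-trivial): it commutes with all translations and all Heisenberg-character modulations (§1; every
character `u ↦ ψ(ξ · u)` is `χ_{T y}` for `y = T⁻¹ ξ`), so the tree's `L²` Stone–von Neumann theorem
`hasScalarCommutant_schrodingerSystem_pi` applies. [cite: MoeglinVignerasWaldspurger1987, Chap. 2 I.2–I.3] -/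
theorem hasScalarCommutant_schrodingerL2 [IsUltrametricDist F] [ProperSpace F] (hψc : Continuous ψ) (hT : IsUnit T.det)
    (hψ1 : ∃ t, ψ t ≠ 1) :
    HasScalarCommutant (Lp ℂ 2 ν)
      (Set.range fun h : Heisenberg (polar (Matrix.toLinearMap₂' F T)) =>
        ⇑(schrodingerL2 (Matrix.toLinearMap₂' F T) ψ hψl (continuous_matrixPairing_left T) ν hd h)) := by
  intro A hA
  refine hasScalarCommutant_schrodingerSystem_pi ψ hψc hψ1 n ν (Set.range (heisChar ψ hψc (n := n))) subset_rfl A ?_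
  intro S hS f
  rcases hS with ⟨x, rfl⟩ | ⟨c, ⟨ξ, rfl⟩, rfl⟩
  · have h := hA _ ⟨⟨(x, 0), 0⟩, rfl⟩ f
    simpa only [schrodingerL2_inl_apply] using h
  · -- the character `χ_ξ` is `χ_{T y}` for `y = T⁻¹ ξ`
    have hTinv : T.mulVec ((T⁻¹).mulVec ξ) = ξ := by
      rw [Matrix.mulVec_mulVec, Matrix.mul_nonsing_inv _ hT, Matrix.one_mulVec]
    have h := hA _ ⟨⟨(0, (T⁻¹).mulVec ξ), 0⟩, rfl⟩ f
    simpa only [schrodingerL2_inr_apply T ψ hψl ν hd hψc, hTinv] using h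

/-! ## §3 Topological irreducibility -/

/-- **IRREDUCIBILITY of the unitary Schrödinger representation on `L²(Fⁿ, ν)`**: a CLOSED subspace `K` invariant under
every `ρ_ψ(h)` is `⊥` or `⊤`.  Proof: by unitarity the `ρ_ψ(h)` also preserve `Kᗮ`, so the orthogonal projection onto `K`
commutes with them and is a scalar `a` (§2); `a ∈ {0, 1}`. — "`ρ_ψ` … an irreducible unitary representation of `H(W)`
with central character `ψ`". [cite: GelbartRogawski1991, §3.1 p. 454 L19–21] [cite: MoeglinVignerasWaldspurger1987, Chap. 2 I.2–I.3] -/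
theorem schrodingerL2_irreducible [IsUltrametricDist F] [ProperSpace F] (hψc : Continuous ψ) (hT : IsUnit T.det)
    (hψ1 : ∃ t, ψ t ≠ 1)
    (K : Submodule ℂ (Lp ℂ 2 ν)) (hKc : IsClosed (K : Set (Lp ℂ 2 ν)))
    (hK : ∀ (h : Heisenberg (polar (Matrix.toLinearMap₂' F T))), ∀ f ∈ K,
      schrodingerL2 (Matrix.toLinearMap₂' F T) ψ hψl (continuous_matrixPairing_left T) ν hd h f ∈ K) :
    K = ⊥ ∨ K = ⊤ := by
  haveI : CompleteSpace K := hKc.completeSpace_coe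
  set ρ := schrodingerL2 (Matrix.toLinearMap₂' F T) ψ hψl (continuous_matrixPairing_left T) ν hd with hρ
  -- the unitary operators behind `ρ`: `ρ h f = U h f`
  set U := (isL2Isometric_schrodingerSB (Matrix.toLinearMap₂' F T) ψ hψl (continuous_matrixPairing_left T)
    ν).toUnitaryRep hd with hU
  have hρU : ∀ h f, ρ h f = U h f := fun h f => rfl
  -- `ρ h` preserves `Kᗮ` (unitarity + invariance of `K` under `ρ h⁻¹`)
  have hKo : ∀ h, ∀ g ∈ Kᗮ, ρ h g ∈ Kᗮ := by
    intro h g hg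
    rw [Submodule.mem_orthogonal] at hg ⊢
    intro m hm
    have hm' : U h⁻¹ m ∈ K := hK h⁻¹ m hm
    have e : U h (U h⁻¹ m) = m := by
      rw [← show (U h * U h⁻¹) m = U h (U h⁻¹ m) from rfl, ← map_mul, mul_inv_cancel, map_one]
      rfl
    calc ⟪m, ρ h g⟫_ℂ = ⟪U h (U h⁻¹ m), U h g⟫_ℂ := by rw [e, hρU]
      _ = ⟪U h⁻¹ m, g⟫_ℂ := (U h).inner_map_map _ _
      _ = 0 := hg _ hm'
  -- the orthogonal projection onto `K` commutes with every `ρ h`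
  have hP : ∀ h f, K.starProjection (ρ h f) = ρ h (K.starProjection f) := by
    intro h f
    have h1 : ρ h (K.starProjection f) ∈ K := hK h _ (K.starProjection_apply_mem f)
    have h2 : ρ h (f - K.starProjection f) ∈ Kᗮ := hKo h _ (K.sub_starProjection_mem_orthogonal f)
    exact Submodule.eq_starProjection_of_mem_orthogonal' h1 h2 (by rw [← map_add, add_sub_cancel])
  -- hence it is a scalar `a`, and `a ∈ {0, 1}`
  obtain ⟨a, ha⟩ := hasScalarCommutant_schrodingerL2 T ψ hψl ν hd hψc hT hψ1 K.starProjection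
    (by rintro S ⟨h, rfl⟩ f; exact hP h f)
  rcases eq_or_ne K ⊥ with hbot | hne
  · exact Or.inl hbot
  · right
    obtain ⟨k, hkK, hk0⟩ := Submodule.exists_mem_ne_zero_of_ne_bot hne
    have ha1 : a = 1 := by
      have e1 : K.starProjection k = k := Submodule.starProjection_eq_self_iff.2 hkK
      rw [ha] at e1
      have e2 : (a - 1) • k = 0 := by rw [sub_smul, one_smul, e1, sub_self]
      rcases smul_eq_zero.1 e2 with h0 | h0
      · exact sub_eq_zero.1 h0
      · exact absurd h0 hk0
    refine Submodule.eq_top_iff'.2 fun f => ?_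
    rw [← Submodule.starProjection_eq_self_iff (K := K), ha, ha1, one_smul]

end Literature.RepresentationTheory.HeisenbergGroup

end
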